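import Literature.NumberTheory.LFunctions.MoebiusWalshKatai
import Literature.NumberTheory.LFunctions.MoebiusWalshDyadic
import Literature.NumberTheory.LFunctions.MoebiusWalshCircuitsProofs
import Literature.NumberTheory.Sieve.MoebiusWalshCircuitsProofs
import HarnessLib

/-!
# Green 2012, Proposition 2 in the `walshSum` / `dyadicExpSum` vocabulary

Topic `Literature/NumberTheory/LFunctions`. The proved Proposition 2 of B. Green, *On (not)
computing the Möbius function using bounded depth circuits*, Combin. Probab. Comput. 21 (2012),
§3 (`Katai.exists_sparseDyadic_of_large_walshSum`, file `MoebiusWalshKatai.lean`) restated for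
an integer sequence `g` with `|g| ≤ 1` (`μ`, `λ`) in the vocabulary of the named facts of
`MoebiusWalshCircuits.lean` — the cube sum
`walshSum g S = Σ_{x ∈ {0,1}ⁿ} g(val x) Π_{j∈S}(−1)^{x_j}` — and of the Bourgain layer
`MoebiusWalshCircuitsProofs.lean` — the exponential sum
`MoebiusWalsh.dyadicExpSum n g θ = Σ_{m<2ⁿ} g(m) e(θm)`:

* `walshSum_eq_sum_range_testBit`: `walshSum g S = Σ_{m<2ⁿ} g(m) Π_{j∈S} (−1)^{bit_j(m)}`
  (`MoebiusWalsh.sum_digits_eq_sum_range` of the Bourgain layer and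
  `Literature.NumberTheory.Sieve.MoebiusWalsh.testBit_bitsToNat_ofFn` of the `Sieve` bridge file);
* `exists_sparseDyadic_dyadicExpSum_ge`: if `|walshSum g S| ≥ δ 2ⁿ`, `0 < δ`, `S ≠ ∅`,
  then `|dyadicExpSum n g θ| ≥ (δ/2)(2R+1)^{-|S|} 2ⁿ` for a sparse dyadic rational
  `θ = Σ_{j∈S} r_j/2^{j+1}`, `|r_j| ≤ R = ⌈64|S|²/δ²⌉`; `exists_sparseDyadic_dyadicExpSum_ge'`
  gives Green's printed shape `|r_j| ≤ (12k/δ)²`, `≥ (δ/(12k))^{4k} 2ⁿ` for `δ ≤ 1/2`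
  (`katai_constants`);
* `twoPower_of_digitDyadic_near`: Green's §4 Lemma 1 (Harman–Kátai; the tree's
  `twoPower_of_sparseDyadic_near` of `MoebiusWalshDyadic.lean`) restated for exactly these
  digit-indexed frequencies `θ = Σ_{j∈S} r_j/2^{j+1}`, the glue needed in Green's Proposition 3.

This is the form in which Proposition 2 and Lemma 1 enter the proof of Proposition 1
(`green_moebius_fourierWalsh`, `green_liouville_fourierWalsh`).

## References

* B. Green, *On (not) computing the Möbius function using bounded depth circuits*, Combin.
  Probab. Comput. 21 (2012), §3 Proposition 2 [Green2012].
-/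

noncomputable section

open Finset
open scoped FourierTransform
open Literature.Computability.Complexity (bitsToNat)

namespace Literature.NumberTheory.LFunctions

/-- **The cube Walsh sum over `{0, …, 2ⁿ − 1}`**:
`walshSum g S = Σ_{m<2ⁿ} g(m) Π_{j∈S} (−1)^{bit_j(m)}` (as a complex number). [folklore] -/
theorem walshSum_eq_sum_range_testBit {n : ℕ} (g : ℕ → ℤ) (S : Finset (Fin n)) :
    ((walshSum g S : ℝ) : ℂ) =
      ∑ m ∈ range (2 ^ n), (g m : ℂ) * ∏ j ∈ S, (if m.testBit j then (-1 : ℂ) else 1) := by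
  unfold walshSum
  rw [Complex.ofReal_sum, ← MoebiusWalsh.sum_digits_eq_sum_range n
    (fun m => (g m : ℂ) * ∏ j ∈ S, (if m.testBit j then (-1 : ℂ) else 1))]
  refine Finset.sum_congr rfl fun x _ => ?_
  rw [Complex.ofReal_mul, Complex.ofReal_intCast, Complex.ofReal_prod]
  congr 1
  refine Finset.prod_congr rfl fun j _ => ?_
  rw [Literature.NumberTheory.Sieve.MoebiusWalsh.testBit_bitsToNat_ofFn]
  split_ifs <;> simp

/-- **Green 2012, Proposition 2, for an integer sequence** (`|g| ≤ 1`; `g = μ, λ`): a large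
Fourier–Walsh coefficient `|walshSum g S| / 2ⁿ ≥ δ` (`0 < δ`, `S ≠ ∅`, `|S| = k`) forces
a large exponential sum `|Σ_{m<2ⁿ} g(m) e(θm)| ≥ (δ/2)(2R+1)^{-k} 2ⁿ` at a sparse dyadic rational
`θ = Σ_{j∈S} r_j/2^{j+1}` with `|r_j| ≤ R = ⌈64k²/δ²⌉` (printed: `(δ/10k)^{4k}`,
`|rᵢ| ≤ (10k/δ)³`, same shape up to absolute constants). [cite: Green2012, Proposition 2] -/
theorem exists_sparseDyadic_dyadicExpSum_ge {n : ℕ} (g : ℕ → ℤ) (hg : ∀ m, |g m| ≤ 1)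
    (S : Finset (Fin n)) (hS : S.Nonempty) {δ : ℝ} (hδ0 : 0 < δ)
    (hbig : δ ≤ |walshSum g S| / 2 ^ n) :
    ∃ r : Fin n → ℤ, (∀ j, |r j| ≤ (⌈64 * (S.card : ℝ) ^ 2 / δ ^ 2⌉₊ : ℕ)) ∧ (∀ j ∉ S, r j = 0) ∧
      δ / 2 / (2 * (⌈64 * (S.card : ℝ) ^ 2 / δ ^ 2⌉₊ : ℕ) + 1 : ℝ) ^ S.card * 2 ^ n ≤
        ‖MoebiusWalsh.dyadicExpSum n g (∑ j ∈ S, (r j : ℝ) / 2 ^ ((j : ℕ) + 1))‖ := by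
  classical
  have hbig' : δ * 2 ^ n ≤ |walshSum g S| := by
    rwa [le_div_iff₀ (by positivity)] at hbig
  obtain ⟨r, hr, hge⟩ := Katai.exists_sparseDyadic_of_large_walshSum g hg S hS hδ0 hbig'
  refine ⟨fun j => if j ∈ S then r j else 0, fun j => ?_, fun j hj => if_neg hj, ?_⟩
  · dsimp only
    by_cases hj : j ∈ S
    · rw [if_pos hj]; exact hr j hj
    · rw [if_neg hj, abs_zero]; exact Nat.cast_nonneg _
  · have hθ : ∑ j ∈ S, (((if j ∈ S then r j else 0 : ℤ)) : ℝ) / 2 ^ ((j : ℕ) + 1) =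
        ∑ j ∈ S, (r j : ℝ) / 2 ^ ((j : ℕ) + 1) :=
      Finset.sum_congr rfl fun j hj => by rw [if_pos hj]
    have hE : MoebiusWalsh.dyadicExpSum n g (∑ j ∈ S, (r j : ℝ) / 2 ^ ((j : ℕ) + 1)) =
        ∑ x ∈ range (2 ^ n), (g x : ℂ) * (𝐞 ((∑ j ∈ S, (r j : ℝ) / 2 ^ ((j : ℕ) + 1)) * x) : ℂ) :=
      rfl
    rw [hθ, hE]
    refine le_trans (le_of_eq ?_) hge
    simp only [Katai.kataiR]
    ring

/-- The constants in Green's printed shape: with `k = |S| ≥ 1`, `0 < δ ≤ 1/2` and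
`R = ⌈64k²/δ²⌉`, one has `R ≤ (12k/δ)²` and `(δ/(12k))^{4k} ≤ (δ/2)(2R+1)^{-k}`. [cite: Green2012, Proposition 2] -/
theorem katai_constants {k : ℕ} (hk : 1 ≤ k) {δ : ℝ} (hδ0 : 0 < δ) (hδ : δ ≤ 1 / 2) :
    ((⌈64 * (k : ℝ) ^ 2 / δ ^ 2⌉₊ : ℕ) : ℝ) ≤ (12 * k / δ) ^ 2 ∧
      (δ / (12 * k)) ^ (4 * k) ≤ δ / 2 / (2 * (⌈64 * (k : ℝ) ^ 2 / δ ^ 2⌉₊ : ℕ) + 1 : ℝ) ^ k := by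
  have hkR : (1 : ℝ) ≤ k := by exact_mod_cast hk
  set R : ℕ := ⌈64 * (k : ℝ) ^ 2 / δ ^ 2⌉₊ with hR
  have hRlt : (R : ℝ) < 64 * (k : ℝ) ^ 2 / δ ^ 2 + 1 := Nat.ceil_lt_add_one (by positivity)
  -- `k²/δ² ≥ 4`
  have hkd : 4 ≤ (k : ℝ) ^ 2 / δ ^ 2 := by
    rw [le_div_iff₀ (by positivity)]; nlinarith
  set u : ℝ := δ / (12 * k) with hu
  have hu0 : 0 < u := by positivity
  have hu2 : u ^ 2 = δ ^ 2 / (144 * (k : ℝ) ^ 2) := by rw [hu]; field_simp; ring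
  have hinv : 1 / u ^ 2 = 144 * (k : ℝ) ^ 2 / δ ^ 2 := by rw [hu2]; field_simp
  have hA : 2 * (R : ℝ) + 1 ≤ 1 / u ^ 2 := by
    rw [hinv]
    have : (3 : ℝ) ≤ 16 * ((k : ℝ) ^ 2 / δ ^ 2) := by linarith
    have e : 144 * (k : ℝ) ^ 2 / δ ^ 2 = 128 * ((k : ℝ) ^ 2 / δ ^ 2) + 16 * ((k : ℝ) ^ 2 / δ ^ 2) := by ring
    have e2 : 64 * (k : ℝ) ^ 2 / δ ^ 2 = 64 * ((k : ℝ) ^ 2 / δ ^ 2) := by ring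
    rw [e2] at hRlt
    linarith
  refine ⟨?_, ?_⟩
  · calc (R : ℝ) ≤ 64 * (k : ℝ) ^ 2 / δ ^ 2 + 1 := hRlt.le
      _ ≤ 144 * (k : ℝ) ^ 2 / δ ^ 2 := by
          have : (1 : ℝ) ≤ 80 * ((k : ℝ) ^ 2 / δ ^ 2) := by linarith
          have e : 144 * (k : ℝ) ^ 2 / δ ^ 2 = 64 * (k : ℝ) ^ 2 / δ ^ 2 + 80 * ((k : ℝ) ^ 2 / δ ^ 2) := by ring
          linarith
      _ = (12 * k / δ) ^ 2 := by field_simp; ring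
  · have hpos : (0 : ℝ) < 2 * R + 1 := by positivity
    -- `(2R+1)^k ≤ (1/u²)^k`, so `δ/2/(2R+1)^k ≥ (δ/2) u^{2k}`
    have h1 : δ / 2 * u ^ (2 * k) ≤ δ / 2 / (2 * (R : ℝ) + 1) ^ k := by
      rw [le_div_iff₀ (by positivity)]
      have h2 : (2 * (R : ℝ) + 1) ^ k ≤ (1 / u ^ 2) ^ k := pow_le_pow_left₀ hpos.le hA k
      have h3 : u ^ (2 * k) * (1 / u ^ 2) ^ k = 1 := by
        rw [pow_mul, ← mul_pow, mul_one_div, div_self (by positivity), one_pow]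
      calc δ / 2 * u ^ (2 * k) * (2 * (R : ℝ) + 1) ^ k ≤ δ / 2 * u ^ (2 * k) * (1 / u ^ 2) ^ k := by
            exact mul_le_mul_of_nonneg_left h2 (by positivity)
        _ = δ / 2 := by rw [mul_assoc, h3, mul_one]
    -- `u^{4k} ≤ (δ/2) u^{2k}` since `u^{2k} ≤ u² ≤ δ/2`
    have hu1 : u ≤ 1 := by
      rw [hu, div_le_one (by positivity)]; nlinarith
    have h4 : u ^ (2 * k) ≤ u ^ 2 := pow_le_pow_of_le_one hu0.le hu1 (by omega)
    have h5 : u ^ 2 ≤ δ / 2 := by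
      rw [hu2, div_le_div_iff₀ (by positivity) (by norm_num)]
      have h6 : δ ^ 2 * 2 ≤ δ * 1 := by nlinarith
      have h7 : δ * 1 ≤ δ * (144 * (k : ℝ) ^ 2) := mul_le_mul_of_nonneg_left (by nlinarith) hδ0.le
      linarith
    calc u ^ (4 * k) = u ^ (2 * k) * u ^ (2 * k) := by rw [← pow_add]; ring_nf
      _ ≤ (δ / 2) * u ^ (2 * k) := by
          exact mul_le_mul_of_nonneg_right (h4.trans h5) (by positivity)
      _ ≤ _ := h1

/-- **Green 2012, Proposition 2, printed shape** (`|g| ≤ 1`, `S ≠ ∅` of size `k`, `0 < δ ≤ 1/2`,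
`|walshSum g S| ≥ δ 2ⁿ`): there is a sparse dyadic rational `θ = Σ_{j∈S} r_j/2^{j+1}` with
`|r_j| ≤ (12k/δ)²` and `|Σ_{m<2ⁿ} g(m) e(θm)| ≥ (δ/(12k))^{4k} 2ⁿ` (Green: `|rᵢ| ≤ (10k/δ)³`,
`|f̂(θ)| ≥ (δ/10k)^{4k}`; the absolute constants are immaterial for Proposition 1).
[cite: Green2012, Proposition 2] -/
theorem exists_sparseDyadic_dyadicExpSum_ge' {n : ℕ} (g : ℕ → ℤ) (hg : ∀ m, |g m| ≤ 1)
    (S : Finset (Fin n)) (hS : S.Nonempty) {δ : ℝ} (hδ0 : 0 < δ) (hδ : δ ≤ 1 / 2)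
    (hbig : δ ≤ |walshSum g S| / 2 ^ n) :
    ∃ r : Fin n → ℤ, (∀ j, |(r j : ℝ)| ≤ (12 * S.card / δ) ^ 2) ∧ (∀ j ∉ S, r j = 0) ∧
      (δ / (12 * S.card)) ^ (4 * S.card) * 2 ^ n ≤
        ‖MoebiusWalsh.dyadicExpSum n g (∑ j ∈ S, (r j : ℝ) / 2 ^ ((j : ℕ) + 1))‖ := by
  obtain ⟨r, hr, hr0, hge⟩ := exists_sparseDyadic_dyadicExpSum_ge g hg S hS hδ0 hbig
  obtain ⟨hRle, hpow⟩ := katai_constants (Finset.card_pos.2 hS) hδ0 hδ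
  refine ⟨r, fun j => ?_, hr0, ?_⟩
  · calc |(r j : ℝ)| = ((|r j| : ℤ) : ℝ) := (Int.cast_abs).symm
      _ ≤ ((⌈64 * (S.card : ℝ) ^ 2 / δ ^ 2⌉₊ : ℕ) : ℝ) := by exact_mod_cast hr j
      _ ≤ (12 * S.card / δ) ^ 2 := hRle
  · exact le_trans (mul_le_mul_of_nonneg_right hpow (by positivity)) hge

/-- **Green 2012, Lemma 1, for digit-indexed sparse dyadic rationals** (the output format of
Proposition 2, `Katai.exists_sparseDyadic_of_large_walshSum`: `θ = Σ_{j ∈ S} r_j/2^{j+1}`,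
`S ⊆ Fin n`): if `|r_j| ≤ Q` on `S`, `1 ≤ q ≤ Q`, `(a, q) = 1`, `|θ − a/q| ≤ Q/2ⁿ`,
`(|S| + 1) g ≤ n` and `4Q² < 2^g`, then `q` is a power of two. [cite: Green2012, §4 Lemma 1] -/
theorem twoPower_of_digitDyadic_near {n g : ℕ} {Q : ℝ} (S : Finset (Fin n)) (r : Fin n → ℤ)
    (hr : ∀ j ∈ S, |(r j : ℝ)| ≤ Q) {q : ℕ} (hq : 1 ≤ q) (hqQ : (q : ℝ) ≤ Q) {a : ℤ}
    (hcop : Int.gcd a q = 1)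
    (hθ : |∑ j ∈ S, (r j : ℝ) / 2 ^ ((j : ℕ) + 1) - a / q| ≤ Q / 2 ^ n)
    (hkg : (S.card + 1) * g ≤ n) (hgap : 4 * Q ^ 2 < (2 : ℝ) ^ g) :
    ∃ e : ℕ, q = 2 ^ e := by
  classical
  set φ := S.equivFin with hφ
  set i : Fin S.card → ℕ := fun l => ((φ.symm l : S) : Fin n) + 1 with hi
  set r' : Fin S.card → ℤ := fun l => r (φ.symm l) with hr'
  have hinj : Function.Injective i := by
    intro l l' h
    simp only [hi, add_left_inj] at h
    exact φ.symm.injective (Subtype.ext (Fin.ext h))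
  have hsum : ∑ l, (r' l : ℝ) / 2 ^ (i l) = ∑ j ∈ S, (r j : ℝ) / 2 ^ ((j : ℕ) + 1) := by
    rw [← Finset.sum_coe_sort S]
    exact Equiv.sum_comp φ.symm (fun s : S => (r s : ℝ) / 2 ^ (((s : Fin n) : ℕ) + 1))
  refine twoPower_of_sparseDyadic_near i hinj r' (fun l => hr _ (φ.symm l).2) hq hqQ hcop ?_ hkg hgap
  rw [hsum]
  exact hθ


end Literature.NumberTheory.LFunctions

end
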